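import Summits.BirchSwinnertonDyer.Rank1Residual.X11a.SelmerCompanionResidueCertificate
import HarnessLib

/-!
# Route (3e) SELMER COMPANION, XXV: the residue certificate READ IN `Ã(ℤ/p)` — the reduction of a
# rational point of the minimal model has coordinates `x mod p`, `y mod p`
# (class X11a = N7; cell `b2b-bsdres`, unit `b2b-bsdres-x11a`, gen 30)

HONEST FRAMING (run/shared/lean/b2b/bsd-rank1-residual/, verbatim in every file): the goal of the
cell is to DELETE the COMBINATION-SHAPED residual classes of the Birch–Swinnerton-Dyer formula for
ALL analytic-rank `≤ 1` elliptic curves over `ℚ` — "full BSD formula for every rank `≤ 1` curve in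
class `C`" assembled STRICTLY from published theorems — so that the rank-`≤ 1` remainder becomes
exactly the CONSTRUCTION-SHAPED classes, which are TYPED (missing-input `Prop`s), NOT attempted.
This is not "finishing BSD". CLASS-OWNERS.md: research routes; NO CLAIM BEYOND STATED CLASSES.
THEOREMS ONLY; nothing booked; no label moves.

## What this file proves

Files XXIII/XXIV state the strictness certificate of a closed rank-one partner `A` as
`#Ã(𝔽_ℓ) = p·n ∧ n • red₀ g ≠ 0`, with `red₀` the tree's reduction map of the minimal model of `A`
on `A(K̄_v)` (values in the points of `A_ℤ ⊗ 𝒪_w mod 𝔪_w` over the residue field `k_w` of `K̄_v`).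
The census computes in `Ã(ℤ/ℓ) = (reductionModPrime A ℓ)(ZMod ℓ)`, on the point
`(x mod ℓ, y mod ℓ)` for Cremona's generator `g = (x, y)` with `ℓ`-integral coordinates. This file
proves the two are the same computation:

* `spectralValuation_algebraMap_rat_le_one` — a rational number with denominator prime to `ℓ` is
  `w`-integral in `K̄_v` (`v ∋ ℓ`);
* `nsmul_localRed_toGeomPoints_eq_zero_iff` — for `g = (x, y) ∈ A(ℚ)` with `ℓ ∤ den x`,
  `ℓ ∤ den y`: the point `g̃ = (x̄, ȳ)`, `x̄ = (x : ZMod ℓ)`, lies on `reductionModPrime A ℓ`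
  (nonsingular), and for every `n`, **`n • red₀ g = 0 ↔ n • g̃ = 0` in `Ã(ℤ/ℓ)`**. PROOF: `red₀ g`
  is the point `(res_w x, res_w y)` of the reduction over `k_w` (`reducePoint_congrEquiv_some_of_val_le_one`);
  along `k_v ≃ ℤ/ℓ` (`exists_residueField_ringEquiv_zmod`, compatible with the integers) and the
  residue-field map `k_v → k_w` of the structure map `ℤ_v → 𝒪_w`
  (`exists_ringHom_adicCompletionIntegers_integer`), both `red₀ g` and `g̃` are images of ONE point
  of `(A_ℤ ⊗ k_v)(k_v)` under injective homomorphisms (`mapPointHom`), because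
  `res_w(x)·den x = num x` and `x̄·den x = num x` with `den x` a unit.

So the hypothesis `hg : n • red₀ g ≠ 0` of the booking theorems of file XXIV is, literally, the
finite computation `n • (x̄, ȳ) ≠ O` in the group of `ℤ/ℓ`-points of `reductionModPrime A ℓ`
(`(nsmul_localRed_toGeomPoints_eq_zero_iff …).not`). Not a class theorem; nothing booked.

References: [SilvermanAEC2009] VII.2.1, VII.§2; files XXIII, XXIV; HOME/b2b-bsdres-x11a/REPORT-g30.md.
-/

set_option autoImplicit false

noncomputable section

open scoped Classical NNReal

open WeierstrassCurve Literature.NumberTheory.EllipticCurves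
  Literature.NumberTheory.GaloisRepresentations Field NumberField IsDedekindDomain
  IsDedekindDomain.HeightOneSpectrum Literature.NumberTheory.EllipticCurves.FormalGroupChart
  Literature.NumberTheory.EllipticCurves.Rank1Residual
  Literature.NumberTheory.EllipticCurves.Rank1Residual.Typed

namespace Summit.BirchSwinnertonDyer.Rank1Residual.X11a.SelmerCompanion

variable (A : WeierstrassCurve ℚ) [A.IsGloballyMinimal] {p : ℕ} [hp : Fact p.Prime]
  {v : HeightOneSpectrum (𝓞 ℚ)} (hpv : (p : 𝓞 ℚ) ∈ v.asIdeal)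
  {w : Valuation (AlgebraicClosure (v.adicCompletion ℚ)) ℝ≥0}
  (hw : ∀ x, (w x : ℝ) = spectralNorm (v.adicCompletion ℚ) (AlgebraicClosure (v.adicCompletion ℚ)) x)
  (hΔu : IsUnit ((integralModelInt A).map (algebraMap ℤ ↥w.valuationSubring)).Δ)
  (red₀ : localPoints A (v.adicCompletion ℚ) →+
    (((integralModelInt A).map (algebraMap ℤ ↥w.valuationSubring)).map
      (IsLocalRing.residue ↥w.valuationSubring)).toAffine.Point)
  (hred₀ : ∀ P : localPoints A (v.adicCompletion ℚ), red₀ P =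
    ((integralModelInt A).map (algebraMap ℤ ↥w.valuationSubring)).reducePoint
      (Affine.Point.congrEquiv (localIntModel_baseChange A w.valuationSubring).symm P))

/-! ## §1 `ℓ`-integral rationals are `w`-integral -/

include hw in
omit [A.IsGloballyMinimal] hp in
/-- An integer is `w`-integral in `K̄_v` (it lies in `ℤ_v`). [folklore] -/
theorem spectralValuation_intCast_le_one (n : ℤ) :
    w ((n : ℤ) : AlgebraicClosure (v.adicCompletion ℚ)) ≤ 1 := by
  have h := (spectralValuation_algebraMap_le_one_iff hw ((n : ℤ) : v.adicCompletion ℚ)).mpr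
    (intCast_mem (v.adicCompletionIntegers ℚ) n)
  rwa [map_intCast] at h

include hpv hw in
omit [A.IsGloballyMinimal] in
/-- **A rational number with denominator prime to `p` is `w`-integral in `K̄_v`**, `v ∋ p`:
`w(x) = w(num x) / w(den x)` with `w(den x) = 1` (`spectralValuation_intCast_eq_one_of_natCast_mem`).
[folklore] -/
theorem spectralValuation_algebraMap_rat_le_one {x : ℚ} (hx : ¬ p ∣ x.den) :
    w (algebraMap ℚ (AlgebraicClosure (v.adicCompletion ℚ)) x) ≤ 1 := by
  have hden : w ((x.den : ℤ) : AlgebraicClosure (v.adicCompletion ℚ)) = 1 :=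
    spectralValuation_intCast_eq_one_of_natCast_mem hpv hw (by exact_mod_cast hx)
  have hmul : algebraMap ℚ (AlgebraicClosure (v.adicCompletion ℚ)) x *
      ((x.den : ℤ) : AlgebraicClosure (v.adicCompletion ℚ)) = (x.num : AlgebraicClosure (v.adicCompletion ℚ)) := by
    have h := congrArg (algebraMap ℚ (AlgebraicClosure (v.adicCompletion ℚ))) (Rat.mul_den_eq_num x)
    rwa [map_mul, map_natCast, map_intCast, ← Int.cast_natCast] at h
  have h1 : w (algebraMap ℚ (AlgebraicClosure (v.adicCompletion ℚ)) x) =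
      w (algebraMap ℚ _ x * ((x.den : ℤ) : AlgebraicClosure (v.adicCompletion ℚ))) := by
    rw [map_mul, hden, mul_one]
  rw [h1, hmul]
  exact spectralValuation_intCast_le_one hw x.num

/-! ## §2 Residues of `ℓ`-integral rationals along `k_v ≃ ℤ/p` and `k_v → k_w` -/

include hpv hw in
omit [A.IsGloballyMinimal] in
/-- **The residue of an `ℓ`-integral rational in `k_w` is its class in `ℤ/p`, transported.** For a
ring isomorphism `e : k_v ≃ ℤ/p` compatible with the integers, a local homomorphism
`ι : ℤ_v → 𝒪_w` (the structure map) and `q ∈ ℚ` with `p ∤ den q`: the residue-field map of `ι`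
sends `e⁻¹(q mod p)` to the residue of `q` in `k_w = 𝒪_w/𝔪_w`. (Both sides times the unit
`den q` give the residue of the integer `num q`.) [folklore] -/
theorem residueField_map_symm_ratCast_eq
    (e : IsLocalRing.ResidueField (v.adicCompletionIntegers ℚ) ≃+* ZMod p)
    (he : ∀ m : ℤ, e (IsLocalRing.residue _ (m : v.adicCompletionIntegers ℚ)) = (m : ZMod p))
    (ι : v.adicCompletionIntegers ℚ →+* ↥w.valuationSubring) [IsLocalHom ι]
    {q : ℚ} (hq : ¬ p ∣ q.den)
    (hQ : w (algebraMap ℚ (AlgebraicClosure (v.adicCompletion ℚ)) q) ≤ 1) :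
    IsLocalRing.ResidueField.map ι (e.symm (q : ZMod p)) =
      IsLocalRing.residue ↥w.valuationSubring ⟨algebraMap ℚ _ q, hQ⟩ := by
  have hvO : w.Integers w.valuationSubring := Valuation.valuationSubring.integers w
  have hf : ∀ m : ℤ, IsLocalRing.ResidueField.map ι
      (IsLocalRing.residue _ (m : v.adicCompletionIntegers ℚ)) =
      IsLocalRing.residue ↥w.valuationSubring (m : ↥w.valuationSubring) := by
    intro m
    rw [IsLocalRing.ResidueField.map_residue, map_intCast]
  -- `den q` is non-zero in `ℤ/p` and a unit in `𝒪_w`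
  have hden0 : ((q.den : ℤ) : ZMod p) ≠ 0 := by
    rw [Int.cast_natCast, Ne, ZMod.natCast_eq_zero_iff]; exact hq
  have hdenw : IsLocalRing.residue ↥w.valuationSubring ((q.den : ℤ) : ↥w.valuationSubring) ≠ 0 := by
    rw [Ne, IsLocalRing.residue_eq_zero_iff, IsLocalRing.mem_maximalIdeal, mem_nonunits_iff,
      not_not, hvO.isUnit_iff_valuation_eq_one]
    exact spectralValuation_intCast_eq_one_of_natCast_mem hpv hw (by exact_mod_cast hq)
  -- `q̄ · den = num` in `ℤ/p`, hence after `e⁻¹` and the residue-field map of `ι`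
  have hzmod : (q : ZMod p) * ((q.den : ℤ) : ZMod p) = ((q.num : ℤ) : ZMod p) := by
    rw [Int.cast_natCast, Rat.cast_def, div_mul_cancel₀]
    rw [← Int.cast_natCast]; exact hden0
  have h1 : IsLocalRing.ResidueField.map ι (e.symm (q : ZMod p)) *
      IsLocalRing.residue ↥w.valuationSubring ((q.den : ℤ) : ↥w.valuationSubring) =
      IsLocalRing.residue ↥w.valuationSubring ((q.num : ℤ) : ↥w.valuationSubring) := by
    rw [← hf, ← hf, ← map_mul]
    congr 1
    apply e.injective
    rw [map_mul, RingEquiv.apply_symm_apply, he, he, hzmod]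
  -- `res_w q · res_w den = res_w num`
  have h2 : IsLocalRing.residue ↥w.valuationSubring ⟨algebraMap ℚ _ q, hQ⟩ *
      IsLocalRing.residue ↥w.valuationSubring ((q.den : ℤ) : ↥w.valuationSubring) =
      IsLocalRing.residue ↥w.valuationSubring ((q.num : ℤ) : ↥w.valuationSubring) := by
    rw [← map_mul]
    congr 1
    apply Subtype.ext
    have h := congrArg (algebraMap ℚ (AlgebraicClosure (v.adicCompletion ℚ))) (Rat.mul_den_eq_num q)
    rw [map_mul, map_natCast, map_intCast, ← Int.cast_natCast] at h
    simpa using h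
  exact mul_right_cancel₀ hdenw (h1.trans h2.symm)

/-! ## §3 `red₀ g` and `(x̄, ȳ) ∈ Ã(ℤ/p)` are one computation -/

include hpv hw hΔu hred₀ in
/-- **The residue certificate read in `Ã(ℤ/p)`.** Let `A/ℚ` be globally minimal, `v ∋ p`, `w` the
spectral valuation of `K̄_v`, `red₀` the reduction map of the minimal model `A_ℤ ⊗ 𝒪_w` (unit
discriminant `hΔu`, i.e. `p ∤ Δ_A`) on `A(K̄_v)`, and `g = (x, y) ∈ A(ℚ)` with `p ∤ den x`,
`p ∤ den y`. Then `(x̄, ȳ) = ((x : ZMod p), (y : ZMod p))` is a (nonsingular) point of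
`reductionModPrime A p = A_ℤ mod p`, and for every `n : ℕ`,
`n • red₀ g = 0 ↔ n • (x̄, ȳ) = 0`. In particular the booking hypothesis
`n • red₀ g ≠ 0` of file XXIV is the finite check `n • (x̄, ȳ) ≠ O` in `Ã(ℤ/p)`.
PROOF: both are images of the point `(a, b)` of `(A_ℤ ⊗ k_v)(k_v)`, `a ↦ x̄` under `k_v ≃ ℤ/p`,
`a ↦ res_w(x)` under `k_v → k_w`, under injective homomorphisms; `a` is pinned down by
`a · den x = num x` (`den x` a unit). Silverman, *AEC*, VII.2.1 (reduction of an integral point is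
coordinatewise). [cite: SilvermanAEC2009, Prop. VII.2.1] -/
theorem nsmul_localRed_toGeomPoints_eq_zero_iff {x y : ℚ} (hg : A.toAffine.Nonsingular x y)
    (hx : ¬ p ∣ x.den) (hy : ¬ p ∣ y.den) :
    ∃ hns : (reductionModPrime A p).toAffine.Nonsingular (x : ZMod p) (y : ZMod p),
      ∀ n : ℕ, n • red₀ (pointsMap A (v.adicCompletion ℚ) (toGeomPoints A (.some x y hg))) = 0 ↔
        n • (Affine.Point.some _ _ hns : (reductionModPrime A p).toAffine.Point) = 0 := by
  have hMK := localIntModel_baseChange A w.valuationSubring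
  have hpp := hp.out
  -- the coordinates of `g` in `K̄_v`
  have hX : w (algebraMap ℚ (AlgebraicClosure (v.adicCompletion ℚ)) x) ≤ 1 :=
    spectralValuation_algebraMap_rat_le_one hpv hw hx
  have hY : w (algebraMap ℚ (AlgebraicClosure (v.adicCompletion ℚ)) y) ≤ 1 :=
    spectralValuation_algebraMap_rat_le_one hpv hw hy
  have h' : (A.baseChange (AlgebraicClosure (v.adicCompletion ℚ))).toAffine.Nonsingular
      (algebraMap ℚ _ x) (algebraMap ℚ _ y) :=
    (Affine.map_nonsingular _ (algebraMap ℚ (AlgebraicClosure (v.adicCompletion ℚ))).injective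
      x y).mpr hg
  have hgl : pointsMap A (v.adicCompletion ℚ) (toGeomPoints A (.some x y hg)) =
      (Affine.Point.some _ _ h' : localPoints A (v.adicCompletion ℚ)) := by
    have h₁ : (A.baseChange (AlgebraicClosure ℚ)).toAffine.Nonsingular
        (algebraMap ℚ (AlgebraicClosure ℚ) x) (algebraMap ℚ (AlgebraicClosure ℚ) y) :=
      (Affine.map_nonsingular _ (algebraMap ℚ (AlgebraicClosure ℚ)).injective x y).mpr hg
    have h₂ : toGeomPoints A (.some x y hg) = (Affine.Point.some _ _ h₁ : geomPoints A) := rfl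
    rw [h₂]
    change Affine.Point.map (closureEmb (K := ℚ) (v.adicCompletion ℚ))
      (Affine.Point.some _ _ h₁) = _
    rw [Affine.Point.map_some]
    simp only [Affine.Point.some.injEq]
    exact ⟨AlgHom.commutes _ x, AlgHom.commutes _ y⟩
  -- `red₀ g = (res_w x, res_w y)`
  obtain ⟨hY', hns₁, e₁⟩ := reducePoint_congrEquiv_some_of_val_le_one hΔu hMK _ _ h' hX
  have hredg : red₀ (pointsMap A (v.adicCompletion ℚ) (toGeomPoints A (.some x y hg))) =
      .some (IsLocalRing.residue ↥w.valuationSubring ⟨_, hX⟩)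
        (IsLocalRing.residue ↥w.valuationSubring ⟨_, hY'⟩) hns₁ := by
    rw [hgl, hred₀]; exact e₁
  -- `k_v ≃ ℤ/p` and `k_v → k_w`
  obtain ⟨e, he⟩ := exists_residueField_ringEquiv_zmod v
  have hvp : (Rat.HeightOneSpectrum.primesEquiv v : ℕ) = p :=
    Rat.HeightOneSpectrum.primesEquiv_eq_of_natCast_mem v hpp hpv
  let e' : IsLocalRing.ResidueField (v.adicCompletionIntegers ℚ) ≃+* ZMod p :=
    e.trans (ZMod.ringEquivCongr hvp)
  have he' : ∀ m : ℤ, e' (IsLocalRing.residue _ (m : v.adicCompletionIntegers ℚ)) = (m : ZMod p) := by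
    intro m
    change ZMod.ringEquivCongr hvp (e (IsLocalRing.residue _ (m : v.adicCompletionIntegers ℚ))) = _
    rw [he, map_intCast]
  let eh : IsLocalRing.ResidueField (v.adicCompletionIntegers ℚ) →+* ZMod p := e'.toRingHom
  have heh : ∀ a, eh a = e' a := fun _ ↦ rfl
  have hehinj : Function.Injective eh := e'.injective
  obtain ⟨ι, hι⟩ := exists_ringHom_adicCompletionIntegers_integer (v := v) hw
  let ι' : v.adicCompletionIntegers ℚ →+* ↥w.valuationSubring := ι
  haveI hloc : IsLocalHom ι' := isLocalHom_of_coe_eq hw hι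
  let f : IsLocalRing.ResidueField (v.adicCompletionIntegers ℚ) →+*
      IsLocalRing.ResidueField ↥w.valuationSubring :=
    IsLocalRing.ResidueField.map ι'
  -- the models over `k_v`, `k_w`, `ℤ/p`
  obtain ⟨Mv, hMv⟩ : ∃ Mv : WeierstrassCurve (IsLocalRing.ResidueField (v.adicCompletionIntegers ℚ)),
      Mv = (integralModelInt A).map (algebraMap ℤ _) := ⟨_, rfl⟩
  have hred : Mv.map f = ((integralModelInt A).map (algebraMap ℤ ↥w.valuationSubring)).map
        (IsLocalRing.residue ↥w.valuationSubring) := by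
    rw [hMv, WeierstrassCurve.map_map, WeierstrassCurve.map_map]
    congr 1
    exact RingHom.ext_int _ _
  have hmodp : Mv.map eh = reductionModPrime A p := by
    rw [hMv, WeierstrassCurve.map_map]
    exact congrArg (fun φ : ℤ →+* ZMod p ↦ (integralModelInt A).map φ) (RingHom.ext_int _ _)
  -- the point `(a, b)` over `k_v`: `a = e'⁻¹ x̄` with `f a = res_w x`
  have ha : f (e'.symm (x : ZMod p)) = IsLocalRing.residue ↥w.valuationSubring ⟨_, hX⟩ :=
    residueField_map_symm_ratCast_eq hpv hw e' he' ι' hx hX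
  have hb : f (e'.symm (y : ZMod p)) = IsLocalRing.residue ↥w.valuationSubring ⟨_, hY'⟩ :=
    residueField_map_symm_ratCast_eq hpv hw e' he' ι' hy hY'
  -- nonsingularity of `(a, b)` and of `(x̄, ȳ)`
  have hns' : (Mv.map f).toAffine.Nonsingular (f (e'.symm (x : ZMod p))) (f (e'.symm (y : ZMod p))) := by
    rw [hred, ha, hb]; exact hns₁
  have hab : Mv.toAffine.Nonsingular (e'.symm (x : ZMod p)) (e'.symm (y : ZMod p)) :=
    (Affine.map_nonsingular _ f.injective _ _).mp hns'
  have hns : (reductionModPrime A p).toAffine.Nonsingular (x : ZMod p) (y : ZMod p) := by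
    have h : (Mv.map eh).toAffine.Nonsingular (eh (e'.symm (x : ZMod p))) (eh (e'.symm (y : ZMod p))) :=
      (Affine.map_nonsingular _ hehinj _ _).mpr hab
    rw [hmodp, heh, heh, RingEquiv.apply_symm_apply, RingEquiv.apply_symm_apply] at h
    exact h
  refine ⟨hns, fun n ↦ ?_⟩
  -- `red₀ g` is the image of `(a, b)` under `k_v → k_w` (an injective homomorphism)
  have himg₁ : Affine.Point.congrEquiv hred (mapPointHom Mv f (.some _ _ hab)) =
      red₀ (pointsMap A (v.adicCompletion ℚ) (toGeomPoints A (.some x y hg))) := by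
    rw [mapPointHom_some, Affine.Point.congrEquiv_some, hredg]
    simp only [Affine.Point.some.injEq]
    exact ⟨ha, hb⟩
  have hz₁ : ∀ Q : Mv.toAffine.Point,
      Affine.Point.congrEquiv hred (mapPointHom Mv f Q) = 0 ↔ Q = 0 := fun Q ↦ by
    rw [map_eq_zero_iff _ (Affine.Point.congrEquiv hred).injective]
    exact ⟨fun h ↦ mapPointHom_injective Mv f (h.trans (mapPointHom Mv f).map_zero.symm),
      fun h ↦ by rw [h, (mapPointHom Mv f).map_zero]⟩
  -- `(x̄, ȳ)` is the image of `(a, b)` under `k_v ≃ ℤ/p` (Mathlib's `Point.map`, whose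
  -- decidability instances are those of `ZMod p`)
  letI algZ : Algebra (IsLocalRing.ResidueField (v.adicCompletionIntegers ℚ)) (ZMod p) :=
    eh.toAlgebra
  have hbc : Mv.baseChange (ZMod p) = reductionModPrime A p := hmodp
  let ι₀ : Mv.toAffine.Point ≃+
      (Mv.baseChange (IsLocalRing.ResidueField (v.adicCompletionIntegers ℚ))).toAffine.Point :=
    Affine.Point.congrEquiv (Literature.NumberTheory.EllipticCurves.baseChange_self Mv).symm
  let φZ : (Mv.baseChange (IsLocalRing.ResidueField (v.adicCompletionIntegers ℚ))).toAffine.Point →+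
      (Mv.baseChange (ZMod p)).toAffine.Point :=
    Affine.Point.map (W' := Mv) (Algebra.ofId _ (ZMod p))
  have himg₂ : Affine.Point.congrEquiv hbc (φZ (ι₀ (.some _ _ hab))) =
      (Affine.Point.some _ _ hns : (reductionModPrime A p).toAffine.Point) := by
    change Affine.Point.congrEquiv hbc (Affine.Point.map (W' := Mv) (Algebra.ofId _ (ZMod p))
      (Affine.Point.congrEquiv (Literature.NumberTheory.EllipticCurves.baseChange_self Mv).symm
        (.some _ _ hab))) = _
    rw [Affine.Point.congrEquiv_some, Affine.Point.map_some, Affine.Point.congrEquiv_some]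
    simp only [Affine.Point.some.injEq]
    exact ⟨e'.apply_symm_apply _, e'.apply_symm_apply _⟩
  have hz₂ : ∀ Q : Mv.toAffine.Point, Affine.Point.congrEquiv hbc (φZ (ι₀ Q)) = 0 ↔ Q = 0 :=
    fun Q ↦ by
    rw [map_eq_zero_iff _ (Affine.Point.congrEquiv hbc).injective,
      map_eq_zero_iff φZ (Affine.Point.map_injective (W' := Mv) _), map_eq_zero_iff _ ι₀.injective]
  rw [← himg₁, ← himg₂, ← map_nsmul (Affine.Point.congrEquiv hred), ← (mapPointHom Mv f).map_nsmul,
    ← map_nsmul (Affine.Point.congrEquiv hbc), ← map_nsmul φZ, ← map_nsmul ι₀, hz₁, hz₂]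

end Summit.BirchSwinnertonDyer.Rank1Residual.X11a.SelmerCompanion

end
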